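import Summits.ResolutionOfSingularities.ResolutionOfSingularities.Theorems.FrobeniusLadderFInjectiveMacaulayficationE8LineDeformedFiModel
import Summits.ResolutionOfSingularities.ResolutionOfSingularities.Theorems.FrobeniusLadderFInjectiveMacaulayficationCuspE8LineData
import Summits.ResolutionOfSingularities.ResolutionOfSingularities.Theorems.FrobeniusLadderFInjectiveMacaulayficationCuspE8LinePrime
import Summits.ResolutionOfSingularities.ResolutionOfSingularities.Theorems.FrobeniusLadderFInjectiveMacaulayficationCuspE8LineOffStratum
import HarnessLib

/-!
# THE CUSP-DEGENERATE E8-LINE `s³ + (s−1)(z̃² + e²w̃⁵)` HAS AN F-INJECTIVE MACAULAYFICATION BY ONE WEIGHTED BLOW-UP, `char k = 3`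
# (crux `FrobeniusLadder.FInjectiveMacaulayfication` stmt-ResolutionOfSingularities-15315, chain w45a, hole #3; calibration of the relative
# filtered engine `FilteredConeFiModelRel` ordered by res-L1-w45a-plan-1 R12.2 (i); seat res-L1-w45a-stub-2)

[OURS · L1 W4.5a] AI-written; AI review is weaker than expert review. NOT a statement of any manuscript; no named fact.

`g = X₁³ + (X₁−1)(X₃² + X₀²X₂⁵)` in `k[X₀,…,X₃]` (`(e,s,w̃,z̃) = (X 0,…,X 3)`) is the chart `U*` equation of idea-2's move 3 on `f_cusp/𝔽₃`
(ANSWERS-r5 §2; scoping memo `L/res-L1-w45a-stub-2/SCOPING-fcusp-F3.md` §3): bad exactly along the stratum `V(X₁,X₂,X₃)` (the strict transform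
`C̃″` of the cusp curve), with the `(0,10,6,15)`-weighted tangent cone `g₀ = X₁³ − X₃² − X₀²X₂⁵` — an `E₈⁰` cone DEGENERATING at `e = 0`
(`Q″`) — and a second singular but F-pure curve `L = {X₀ = X₁ = X₃ = 0}` of `A₂ × line` points running into the stratum. THEOREMS
(`char k = 3`, the characteristic of the specimen; the weights `(10,15,6)` on `(s,z̃,w̃)`, NOT idea-2's `(4,5,2)`, whose cone fails the engine's
hoff₀): the weighted blow-up of `Spec k[X]/(g)` along the stratum is a proper birational model with domain stalks satisfying the crux
clause at EVERY point (`cuspE8LineFiModel_char3`), and at the generic point `η` of the stratum the `∃`-clause of the registered hole-#3 stub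
`stub_confinedIsoStepStrongPlus` holds (`cuspE8Line_strongPlusStep_char3`; `exists_eta`). One application of `FilteredConeFiModelRel`
(lead p504479) with `J = {1,2,3}`, `N = D = 30`, `c = (0,3,5,2)`, hpow = `E8LineGradedFiModel.veroneseSplitting` verbatim, data
`CuspE8LineData` (p512271), primality `CuspE8LinePrime` (p512511), hoff/hoff₀ `CuspE8LineOffStratum` (Jacobian + Fedder along `L` off its
origin). No definitions, no named facts. [folklore]
-/

set_option linter.dupNamespace false

noncomputable section

open Literature.AlgebraicGeometry.Resolution AlgebraicGeometry MvPolynomial CategoryTheory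

namespace Summit.ResolutionOfSingularities.ResolutionOfSingularities.Theorems.FInjectiveMacaulayfication.CuspE8LineFiModel

open Summit.ResolutionOfSingularities.ResolutionOfSingularities.Theorems.FInjectiveMacaulayfication
open E8LineDeformedFiModel

/-- `g ∈ (X₁, X₂, X₃)`: every term involves a stratum variable. [folklore] -/
theorem g_mem_span_line (k : Type) [Field k] (g : MvPolynomial (Fin 4) k)
    (hg : g = X 1 ^ 3 + (X 1 - 1) * (X 3 ^ 2 + X 0 ^ 2 * X 2 ^ 5)) :
    g ∈ Ideal.span (MvPolynomial.X '' ((({1, 2, 3} : Finset (Fin 4)) : Set (Fin 4))) : Set (MvPolynomial (Fin 4) k)) := by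
  have hX : ∀ i ∈ ({1, 2, 3} : Finset (Fin 4)), (MvPolynomial.X i : MvPolynomial (Fin 4) k) ∈
      Ideal.span (MvPolynomial.X '' ((({1, 2, 3} : Finset (Fin 4)) : Set (Fin 4))) : Set (MvPolynomial (Fin 4) k)) :=
    fun i hi => Ideal.subset_span ⟨i, Finset.mem_coe.mpr hi, rfl⟩
  have e : g = X 1 * (X 1 ^ 2 + (X 3 ^ 2 + X 0 ^ 2 * X 2 ^ 5)) - X 3 * X 3 - X 2 * (X 0 ^ 2 * X 2 ^ 4) := by rw [hg]; ring
  rw [e]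
  refine Ideal.sub_mem _ (Ideal.sub_mem _ ?_ ?_) ?_
  · exact Ideal.mul_mem_right _ _ (hX 1 (by decide))
  · exact Ideal.mul_mem_right _ _ (hX 3 (by decide))
  · exact Ideal.mul_mem_right _ _ (hX 2 (by decide))

/-- The stratum `(x̄₁, x̄₂, x̄₃)` is prime in `k[X]/(g)`. [folklore] -/
theorem isPrime_span_line (k : Type) [Field k] (g : MvPolynomial (Fin 4) k)
    (hg : g = X 1 ^ 3 + (X 1 - 1) * (X 3 ^ 2 + X 0 ^ 2 * X 2 ^ 5)) :
    (Ideal.span ((fun j : Fin 4 => Ideal.Quotient.mk (Ideal.span {g}) (MvPolynomial.X j)) ''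
      ((({1, 2, 3} : Finset (Fin 4)) : Set (Fin 4))))).IsPrime := by
  have heq : Ideal.span ((fun j : Fin 4 => Ideal.Quotient.mk (Ideal.span {g}) (MvPolynomial.X j)) ''
      ((({1, 2, 3} : Finset (Fin 4)) : Set (Fin 4)))) =
      (Ideal.span (MvPolynomial.X '' ((({1, 2, 3} : Finset (Fin 4)) : Set (Fin 4))) : Set (MvPolynomial (Fin 4) k))).map
        (Ideal.Quotient.mk (Ideal.span {g})) := by
    rw [Ideal.map_span, Set.image_image]
  rw [heq]
  haveI := E8LineStrongPlusStep.isPrime_span_X_image (k := k) ((({1, 2, 3} : Finset (Fin 4)) : Set (Fin 4)))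
  refine Ideal.map_isPrime_of_surjective Ideal.Quotient.mk_surjective ?_
  rw [Ideal.mk_ker, Ideal.span_le, Set.singleton_subset_iff]
  exact g_mem_span_line k g hg

/-- The generic point `η` of the stratum exists as a point of `Spec k[X]/(g)`. [folklore] -/
theorem exists_eta (k : Type) [Field k] (g : MvPolynomial (Fin 4) k)
    (hg : g = X 1 ^ 3 + (X 1 - 1) * (X 3 ^ 2 + X 0 ^ 2 * X 2 ^ 5)) :
    ∃ η : ↥(Spec (.of (MvPolynomial (Fin 4) k ⧸ Ideal.span {g}))),
      η.asIdeal = Ideal.span ((fun j : Fin 4 => Ideal.Quotient.mk (Ideal.span {g}) (MvPolynomial.X j)) ''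
        ((({1, 2, 3} : Finset (Fin 4)) : Set (Fin 4)))) :=
  ⟨⟨_, isPrime_span_line k g hg⟩, rfl⟩

/-- **THE CUSP-DEGENERATE E8-LINE HAS AN F-INJECTIVE MACAULAYFICATION, `char k = 3`**: `Spec k[e,s,w̃,z̃]/(g)` has a proper birational
model with domain stalks satisfying the crux clause at every point — the `(10,15,6)`-weighted blow-up along `V(s,w̃,z̃)` (relative filtered
engine). [folklore] -/
theorem cuspE8LineFiModel_char3 (k : Type) [Field k] [CharP k 3] (g : MvPolynomial (Fin 4) k)
    (hg : g = X 1 ^ 3 + (X 1 - 1) * (X 3 ^ 2 + X 0 ^ 2 * X 2 ^ 5)) :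
    ∃ (X' : Scheme.{0}) (π : X' ⟶ Spec (.of (MvPolynomial (Fin 4) k ⧸ Ideal.span {g}))), IsProper π ∧
      Literature.AlgebraicGeometry.Resolution.IsBirational π ∧
      ∀ y : X', IsDomain (X'.presheaf.stalk y) ∧ ∀ d : ℕ, ringKrullDim (X'.presheaf.stalk y) = d →
        ∀ s : Fin d → X'.presheaf.stalk y, (Ideal.span (Set.range s)).radical.IsMaximal →
          RingTheory.Sequence.IsWeaklyRegular (X'.presheaf.stalk y) (List.ofFn s) ∧
          ∀ z : X'.presheaf.stalk y, (∃ e : ℕ, z ^ 3 ^ e ∈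
              Ideal.span ((fun w : X'.presheaf.stalk y => w ^ 3 ^ e) ''
                (Ideal.span (Set.range s) : Set (X'.presheaf.stalk y)))) →
            z ∈ Ideal.span (Set.range s) := by
  haveI : Fact (Nat.Prime 3) := ⟨Nat.prime_three⟩
  obtain ⟨h30, hlow⟩ := CuspE8LineData.initialForm k g hg
  exact FilteredConeFiModelRel.filteredConeFiModelRel 3 k 4 ({1, 2, 3} : Finset (Fin 4)) ⟨1, by decide⟩
    (![0, 10, 6, 15] : Fin 4 → ℕ) 30 30 (![0, 3, 5, 2] : Fin 4 → ℕ) (by norm_num) weights_on_J weights_off_J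
    (E8LineGradedFiModel.veroneseSplitting k) g (X 1 ^ 3 - X 3 ^ 2 - X 0 ^ 2 * X 2 ^ 5) h30.symm hlow
    (CuspE8LineData.g₀_ne_zero k) (CuspE8LinePrime.isPrime_span_g g hg).1 (CuspE8LinePrime.X_ne_zero g hg)
    (CuspE8LineOffStratum.cuspE8Line_offStratum_clause g hg)
    (CuspE8LineOffStratum.cuspE8LineCone_offStratum_clause _ rfl)

/-- **THE STRONG⁺ STEP at the generic point of the stratum of the cusp-degenerate E8-line, `char k = 3`**: the `∃`-clause of the
registered hole-#3 stub `stub_confinedIsoStepStrongPlus` for `X₁ = Spec k[X]/(g)`, `η` the generic point of `V(X₁,X₂,X₃)`. [folklore] -/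
theorem cuspE8Line_strongPlusStep_char3 (k : Type) [Field k] [CharP k 3] (g : MvPolynomial (Fin 4) k)
    (hg : g = X 1 ^ 3 + (X 1 - 1) * (X 3 ^ 2 + X 0 ^ 2 * X 2 ^ 5))
    (η : ↥(Spec (.of (MvPolynomial (Fin 4) k ⧸ Ideal.span {g}))))
    (hη : η.asIdeal = Ideal.span ((fun j : Fin 4 => Ideal.Quotient.mk (Ideal.span {g}) (MvPolynomial.X j)) ''
        ((({1, 2, 3} : Finset (Fin 4)) : Set (Fin 4))))) :
    ∃ (X₂ : Scheme.{0}) (π : X₂ ⟶ Spec (.of (MvPolynomial (Fin 4) k ⧸ Ideal.span {g}))), IsProper π ∧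
      Literature.AlgebraicGeometry.Resolution.IsBirational π ∧
      IsIntegral X₂ ∧ (∀ x : X₂, (∀ d : ℕ, ringKrullDim (X₂.presheaf.stalk x) = d → ∀ s : Fin d → X₂.presheaf.stalk x, (Ideal.span (Set.range s)).radical.IsMaximal → RingTheory.Sequence.IsWeaklyRegular (X₂.presheaf.stalk x) (List.ofFn s))) ∧
      IsIso (π ∣_ ⟨(closure ({η} : Set ↥(Spec (.of (MvPolynomial (Fin 4) k ⧸ Ideal.span {g})))))ᶜ, isClosed_closure.isOpen_compl⟩) ∧
      ∀ x : X₂, π.base x ∈ closure ({η} : Set ↥(Spec (.of (MvPolynomial (Fin 4) k ⧸ Ideal.span {g})))) → ¬ IsClosed ({x} : Set X₂) → (IsDomain (X₂.presheaf.stalk x) ∧ ∀ d : ℕ, ringKrullDim (X₂.presheaf.stalk x) = d → ∀ s : Fin d → X₂.presheaf.stalk x, (Ideal.span (Set.range s)).radical.IsMaximal → RingTheory.Sequence.IsWeaklyRegular (X₂.presheaf.stalk x) (List.ofFn s) ∧ ∀ t : X₂.presheaf.stalk x, (∃ e : ℕ, t ^ 3 ^ e ∈ Ideal.span ((fun z :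 X₂.presheaf.stalk x => z ^ 3 ^ e) '' (Ideal.span (Set.range s) : Set (X₂.presheaf.stalk x)))) → t ∈ Ideal.span (Set.range s)) := by
  haveI : Fact (Nat.Prime 3) := ⟨Nat.prime_three⟩
  obtain ⟨h30, hlow⟩ := CuspE8LineData.initialForm k g hg
  exact FilteredConeFiModelRel.filteredConeFiModelRel_strongPlusStep 3 k 4 ({1, 2, 3} : Finset (Fin 4)) ⟨1, by decide⟩
    (![0, 10, 6, 15] : Fin 4 → ℕ) 30 30 (![0, 3, 5, 2] : Fin 4 → ℕ) (by norm_num) weights_on_J weights_off_J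
    (E8LineGradedFiModel.veroneseSplitting k) g (X 1 ^ 3 - X 3 ^ 2 - X 0 ^ 2 * X 2 ^ 5) h30.symm hlow
    (CuspE8LineData.g₀_ne_zero k) (CuspE8LinePrime.isPrime_span_g g hg).1 (CuspE8LinePrime.X_ne_zero g hg)
    (CuspE8LineOffStratum.cuspE8Line_offStratum_clause g hg)
    (CuspE8LineOffStratum.cuspE8LineCone_offStratum_clause _ rfl) η hη

end Summit.ResolutionOfSingularities.ResolutionOfSingularities.Theorems.FInjectiveMacaulayfication.CuspE8LineFiModel

end
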